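import Summits.QuantumFields.YangMills.Theorems.MirrorModularBoostsHypercubicLimitClosureHalvesDefs
import Summits.QuantumFields.YangMills.Theorems.LangevinControlUVOSLegsAtWeakCouplingCDefs
import HarnessLib

/-!
# Crux `WeakCouplingHypercubicLimit` (stmt-QuantumFields-16120), line `Sketch`, r10 toolkit: the smeared
plane-string functional on `ℤ⁴`-configurations (sub-goals SG-A `curvFunctional_facts`, SG-B0 `curvFunctional_configShift`)

Helper file of the lead (c4) for the r10 skeleton `Cruxes/WeakCouplingHypercubicLimit/Lines/Sketch.lean`.  The
RP-spectral clustering hypothesis `RPSpectral r sch Δ C` (`MirrorModularBoostsHypercubicLimitClosureHalvesDefs`) is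
stated for REAL functionals `Y : LGConfig 4 G → ℝ` of the infinite-lattice configuration that are measurable, bounded
and depend only on the time slab `{e | 1 ≤ e.1 0 ∧ e.1 0 + [e.2 = 0] ≤ T}`.  For an `n`-point test function `F`,
normalisations `m` and spacing `a`, the functional is the real part of the smeared multi-point plane-string sum
`Σ_{q valid} Σ_{y ∈ boxⁿ} F(a y) ∏ₗ (plane (q l) (y l) V − m (q l))` (through `torusLift` it is the OSLegs toolkit's
`fieldObs r L a F m` of `LangevinControlUVOSLegsFromFemtoAndGapStubAssemblyRPObservable`).

* `curvFunctional_facts` (SG-A): measurability (the plane fields are continuous cylinder functions), the bound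
  `|Y V| ≤ (6 (Cₚ + Cₘ))ⁿ Σ_y ‖F(a y)‖` (`6ⁿ` valid plane strings, `|plane| ≤ Cₚ`, `|m| ≤ Cₘ`), and slab support:
  if `F(a y) ≠ 0` forces `1 ≤ y_l⁰`, `y_l⁰ + 1 ≤ T` for every `l`, the four links of every plaquette met lie in
  the slab (`plane_congr_of_slab`);
* `curvFunctional_configShift` (SG-B0): time-translating the configuration by `j e₀` equals time-translating the
  test function by `(j a) e₀` (`translateMulti`), as long as the lattice support and its translate stay inside the
  box (reindexing `y ↦ y + j e₀` on the non-zero terms).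

Refs: OsterwalderSeiler1978 §§2–3; GlimmJaffe1987 §6.1.
-/

noncomputable section

open scoped SchwartzMap BigOperators ComplexConjugate
open MeasureTheory Filter Topology
open Literature.MathematicalPhysics.QuantumFieldTheory Literature.MathematicalPhysics.QuantumLattice
open Literature.MathematicalPhysics.AQFT
open Literature.Probability.LatticeModels (box Site)
open Summit.QuantumFields.YangMills.Cruxes.HypercubicLimit.CouplingResponse
open Summit.QuantumFields.YangMills.Cruxes.OSLegsFromFemtoAndGap.DlrCollarTransfer (plane conn Decay RPPos ConnCS)
open Summit.QuantumFields.YangMills.Cruxes.OSLegsAtWeakCouplingC.Sketch (Separated)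
open Summit.QuantumFields.YangMills.Theorems.OSLegsFromFemtoAndGap

namespace Summit.QuantumFields.YangMills.Theorems.WeakCouplingHypercubicLimit.TraceNormColdPressure

section Helpers

variable {G : Type} [Group G] [TopologicalSpace G] [IsTopologicalGroup G] [CompactSpace G]
  [MeasurableSpace G] [BorelSpace G]

/-- The plane field of orientation `q` at the site `x` of `ℤ⁴` is measurable (continuous on the countable product of
copies of the second-countable group `G ↪ U(N)`). [folklore] -/
theorem measurable_plane (r : LatticeRep G) (q : Fin 4 × Fin 4) (x : Site 4) : Measurable (plane G r q x) := by
  haveI : SecondCountableTopology G :=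
    (r.continuous.isClosedEmbedding r.injective).isEmbedding.secondCountableTopology
  exact (Cruxes.OSLegsFromFemtoAndGap.DlrCollarTransfer.continuous_plane r q x).measurable

omit [IsTopologicalGroup G] [CompactSpace G] [BorelSpace G] in
/-- The centred plane string `∏ₗ (plane (q l) (y l) − m (q l))` is bounded by `(Cₚ + Cₘ)ⁿ`. [folklore] -/
theorem abs_prod_plane_sub_le (r : LatticeRep G) {n : ℕ} (q : Fin n → Fin 4 × Fin 4) (y : Fin n → Site 4)
    {m : Fin 4 × Fin 4 → ℝ} {Cp Cm : ℝ}
    (hCp : ∀ (p : Fin 4 × Fin 4) (x : Site 4) (U : LGConfig 4 G), |plane G r p x U| ≤ Cp) (hCm : ∀ p, |m p| ≤ Cm)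
    (V : LGConfig 4 G) :
    |∏ l, (plane G r (q l) (y l) V - m (q l))| ≤ (Cp + Cm) ^ n := by
  rw [Finset.abs_prod]
  calc _ ≤ ∏ _l : Fin n, (Cp + Cm) := Finset.prod_le_prod (fun _ _ => abs_nonneg _) fun l _ =>
        (abs_sub _ _).trans (add_le_add (hCp _ _ _) (hCm _))
    _ = (Cp + Cm) ^ n := by simp

omit [IsTopologicalGroup G] [CompactSpace G] [BorelSpace G] in
/-- **Slab support of a plane field**: for a valid orientation `q.1 < q.2` and a base site with `1 ≤ x⁰`,
`x⁰ + 1 ≤ T`, the plane field at `x` agrees on two configurations that agree on the time slab `1 ≤ t`,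
`t + [μ = 0] ≤ T` (its four links `(x, i), (x + eᵢ, j), (x + eⱼ, i), (x, j)` lie in the slab). [folklore] -/
theorem plane_congr_of_slab (r : LatticeRep G) {q : Fin 4 × Fin 4} (hq : q.1 < q.2) {x : Site 4} {T : ℕ}
    (hx1 : 1 ≤ x 0) (hxT : x 0 + 1 ≤ T) {U V : LGConfig 4 G}
    (hUV : ∀ e ∈ {e : Literature.MathematicalPhysics.QuantumLattice.ZdEdge 4 |
      1 ≤ e.1 0 ∧ e.1 0 + (if e.2 = 0 then 1 else 0) ≤ T}, U e = V e) :
    plane G r q x U = plane G r q x V := by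
  have hj : q.2 ≠ 0 := fun h => by rw [h] at hq; exact absurd hq (Fin.not_lt.2 (Fin.zero_le _))
  refine Cruxes.OSLegsFromFemtoAndGap.DlrCollarTransfer.isCylinder_plane r q x (fun e he => hUV e ?_)
  obtain ⟨e', he', rfl⟩ := Finset.mem_image.1 (Finset.mem_coe.1 he)
  simp only [originPlaquetteSupport, Finset.mem_insert, Finset.mem_singleton] at he'
  simp only [Set.mem_setOf_eq, sub_neg_eq_add, Pi.add_apply]
  rcases he' with rfl | rfl | rfl | rfl
  · simp only [Pi.zero_apply, zero_add]
    split_ifs <;> omega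
  · simp only [Pi.single_apply, if_neg hj, add_zero]
    split_ifs <;> omega
  · simp only [Pi.single_apply, if_neg hj.symm]
    split_ifs <;> omega
  · simp only [Pi.zero_apply, zero_add, if_neg hj, add_zero]
    omega

omit [IsTopologicalGroup G] [CompactSpace G] [BorelSpace G] in
/-- Time translation of the configuration moves the base site: `plane q x (τ_s V) = plane q (x + s) V`.
[folklore] -/
theorem plane_configShift (r : LatticeRep G) (q : Fin 4 × Fin 4) (x s : Site 4) (V : LGConfig 4 G) :
    plane G r q x (configShift (-s) V) = plane G r q (x + s) V := by
  unfold plane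
  rw [configShift_neg_add]

/-- Translating the lattice point `x` at spacing `a` back by `(j a) e₀` gives the lattice point `x − j e₀`.
[folklore] -/
theorem smul_siteToE_sub_single (a : ℝ) (j : ℕ) (x : Site 4) :
    a • siteToE x - ((j : ℝ) * a) • EuclideanSpace.single (0 : Fin 4) (1 : ℝ) =
      a • siteToE (x - Pi.single 0 (j : ℤ)) := by
  ext i
  simp only [PiLp.sub_apply, PiLp.smul_apply, siteToE_apply, Pi.sub_apply, Pi.single_apply,
    PiLp.single_apply, smul_eq_mul]
  split_ifs <;> push_cast <;> ring

end Helpers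

/-- **Registered sub-goal SG-A `curvFunctional_facts` (line `Sketch`, r10).**  The smeared plane-string
functional on `ℤ⁴`-configurations `Y V = Re Σ_{q valid} Σ_{y ∈ boxⁿ} F(a y) ∏ₗ (plane (q l) (y l) V − m (q l))` is
measurable, bounded by `(6 (Cₚ + Cₘ))ⁿ Σ_y ‖F(a y)‖`, and depends only on the time slab `{1 ≤ t, t + [μ = 0] ≤ T}`
as soon as `F(a y) ≠ 0` forces `1 ≤ y_l⁰`, `y_l⁰ + 1 ≤ T`. [folklore] -/
theorem curvFunctional_facts :
    ∀ (G : Type) [Group G] [TopologicalSpace G] [IsTopologicalGroup G] [CompactSpace G]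
      [MeasurableSpace G] [BorelSpace G] (r : LatticeRep G), ∃ Cp : ℝ, 0 ≤ Cp ∧
      ∀ (L : ℕ) (a : ℝ) (n : ℕ) (F : 𝓢((Fin n → EuclideanSpace ℝ (Fin 4)), ℂ)) (m : Fin 4 × Fin 4 → ℝ) (Cm : ℝ),
        (∀ q, |m q| ≤ Cm) →
        Measurable (fun V : LGConfig 4 G =>
          (∑ q ∈ Fintype.piFinset (fun _ : Fin n => Finset.univ.filter fun p : Fin 4 × Fin 4 => p.1 < p.2),
            ∑ y ∈ Fintype.piFinset (fun _ : Fin n => box 4 L),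
              F (fun l => a • siteToE (y l)) * ((∏ l, (plane G r (q l) (y l) V - m (q l)) : ℝ) : ℂ)).re) ∧
        (∀ V : LGConfig 4 G,
          |(∑ q ∈ Fintype.piFinset (fun _ : Fin n => Finset.univ.filter fun p : Fin 4 × Fin 4 => p.1 < p.2),
            ∑ y ∈ Fintype.piFinset (fun _ : Fin n => box 4 L),
              F (fun l => a • siteToE (y l)) * ((∏ l, (plane G r (q l) (y l) V - m (q l)) : ℝ) : ℂ)).re| ≤
            (6 * (Cp + Cm)) ^ n * ∑ y ∈ Fintype.piFinset (fun _ : Fin n => box 4 L), ‖F (fun l => a • siteToE (y l))‖) ∧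
        (∀ T : ℕ, (∀ y : Fin n → Site 4, F (fun l => a • siteToE (y l)) ≠ 0 → ∀ l, 1 ≤ y l 0 ∧ y l 0 + 1 ≤ T) →
          DependsOn (fun V : LGConfig 4 G =>
            (∑ q ∈ Fintype.piFinset (fun _ : Fin n => Finset.univ.filter fun p : Fin 4 × Fin 4 => p.1 < p.2),
              ∑ y ∈ Fintype.piFinset (fun _ : Fin n => box 4 L),
                F (fun l => a • siteToE (y l)) * ((∏ l, (plane G r (q l) (y l) V - m (q l)) : ℝ) : ℂ)).re)
            {e : Literature.MathematicalPhysics.QuantumLattice.ZdEdge 4 |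
              1 ≤ e.1 0 ∧ e.1 0 + (if e.2 = 0 then 1 else 0) ≤ T}) := by
  intro G _ _ _ _ _ _ r
  obtain ⟨C, hC⟩ := Cruxes.OSLegsFromFemtoAndGap.DlrCollarTransfer.exists_abs_plane_le (G := G) r
  have hCp : ∀ (p : Fin 4 × Fin 4) (x : Site 4) (U : LGConfig 4 G), |plane G r p x U| ≤ max C 0 :=
    fun p x U => (hC p x U).trans (le_max_left _ _)
  refine ⟨max C 0, le_max_right _ _, fun L a n F m Cm hCm => ⟨?_, fun V => ?_, fun T hT => ?_⟩⟩
  · -- measurability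
    refine Complex.measurable_re.comp (Finset.measurable_sum _ fun q _ => Finset.measurable_sum _ fun y _ => ?_)
    exact (Complex.measurable_ofReal.comp (Finset.measurable_prod _ fun l _ =>
      (measurable_plane r (q l) (y l)).sub measurable_const)).const_mul _
  · -- bound
    have hcard : (Fintype.piFinset (fun _ : Fin n => Finset.univ.filter fun p : Fin 4 × Fin 4 => p.1 < p.2)).card =
        6 ^ n := by
      rw [Fintype.card_piFinset_const]
      congr 1
    refine (Complex.abs_re_le_norm _).trans ((norm_sum_le _ _).trans ?_)
    calc _ ≤ ∑ _q ∈ Fintype.piFinset (fun _ : Fin n => Finset.univ.filter fun p : Fin 4 × Fin 4 => p.1 < p.2),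
          (max C 0 + Cm) ^ n *
            ∑ y ∈ Fintype.piFinset (fun _ : Fin n => box 4 L), ‖F (fun l => a • siteToE (y l))‖ := by
          refine Finset.sum_le_sum fun q _ => (norm_sum_le _ _).trans ?_
          rw [Finset.mul_sum]
          refine Finset.sum_le_sum fun y _ => ?_
          rw [norm_mul, Complex.norm_real, Real.norm_eq_abs, mul_comm]
          exact mul_le_mul_of_nonneg_right (abs_prod_plane_sub_le r q y hCp hCm V) (norm_nonneg _)
      _ = _ := by rw [Finset.sum_const, hcard, nsmul_eq_mul, mul_pow, mul_assoc]; push_cast; ring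
  · -- slab support
    intro U V hUV
    refine congrArg Complex.re (Finset.sum_congr rfl fun q hq => Finset.sum_congr rfl fun y _ => ?_)
    by_cases h0 : F (fun l => a • siteToE (y l)) = 0
    · rw [h0, zero_mul, zero_mul]
    · have hq' : ∀ l, (q l).1 < (q l).2 := by simpa [Fintype.mem_piFinset] using hq
      congr 2
      exact Finset.prod_congr rfl fun l _ => by
        rw [plane_congr_of_slab r (hq' l) (hT y h0 l).1 (hT y h0 l).2 hUV]

/-- **Registered sub-goal SG-B0 `curvFunctional_configShift` (line `Sketch`, r10).**  Time-translating the
configuration by `j e₀` in the smeared plane-string sum equals smearing against the time-translated test function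
`translateMulti ((j a) e₀) F`, provided the lattice support of `F` and its translate by `j e₀` stay inside the box
(reindexing `y ↦ y + j e₀`; the terms with `F(a y) = 0` vanish on both sides). [folklore] -/
theorem curvFunctional_configShift :
    ∀ (G : Type) [Group G] [TopologicalSpace G] [IsTopologicalGroup G] [CompactSpace G]
      [MeasurableSpace G] [BorelSpace G] (r : LatticeRep G) (L : ℕ) (a : ℝ) (n : ℕ) (j : ℕ)
      (F : 𝓢((Fin n → EuclideanSpace ℝ (Fin 4)), ℂ)) (m : Fin 4 × Fin 4 → ℝ), 0 < a →
      (∀ y : Fin n → Site 4, F (fun l => a • siteToE (y l)) ≠ 0 →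
        ∀ l, y l ∈ box 4 L ∧ y l + Pi.single 0 (j : ℤ) ∈ box 4 L) →
      ∀ V : LGConfig 4 G,
        (∑ q ∈ Fintype.piFinset (fun _ : Fin n => Finset.univ.filter fun p : Fin 4 × Fin 4 => p.1 < p.2),
          ∑ y ∈ Fintype.piFinset (fun _ : Fin n => box 4 L),
            F (fun l => a • siteToE (y l)) *
              ((∏ l, (plane G r (q l) (y l) (configShift (-Pi.single 0 (j : ℤ)) V) - m (q l)) : ℝ) : ℂ)) =
        ∑ q ∈ Fintype.piFinset (fun _ : Fin n => Finset.univ.filter fun p : Fin 4 × Fin 4 => p.1 < p.2),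
          ∑ y ∈ Fintype.piFinset (fun _ : Fin n => box 4 L),
            translateMulti (((j : ℝ) * a) • EuclideanSpace.single (0 : Fin 4) (1 : ℝ)) F (fun l => a • siteToE (y l)) *
              ((∏ l, (plane G r (q l) (y l) V - m (q l)) : ℝ) : ℂ) := by
  intro G _ _ _ _ _ _ r L a n j F m _ha hF V
  refine Finset.sum_congr rfl fun q _ => ?_
  have htr : ∀ y : Fin n → Site 4,
      (fun l => a • siteToE (y l) - ((j : ℝ) * a) • EuclideanSpace.single (0 : Fin 4) (1 : ℝ)) =
        fun l => a • siteToE (y l - Pi.single 0 (j : ℤ)) :=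
    fun y => funext fun l => smul_siteToE_sub_single a j (y l)
  simp_rw [plane_configShift, translateMulti_apply, htr]
  -- reindex `y ↦ y + j e₀` on the non-zero terms
  refine Finset.sum_bij_ne_zero (fun y _ _ => fun l => y l + Pi.single 0 (j : ℤ)) (fun y _ hne => ?_)
    (fun y₁ _ _ y₂ _ _ h => funext fun l => add_right_cancel (congrFun h l)) (fun y' _ hne => ?_)
    (fun y _ _ => by simp only [add_sub_cancel_right])
  · have hF0 : F (fun l => a • siteToE (y l)) ≠ 0 := fun h => hne (by rw [h, zero_mul])
    exact Fintype.mem_piFinset.2 fun l => (hF y hF0 l).2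
  · have hF0 : F (fun l => a • siteToE (y' l - Pi.single 0 (j : ℤ))) ≠ 0 :=
      fun h => hne (by rw [h, zero_mul])
    exact ⟨fun l => y' l - Pi.single 0 (j : ℤ), Fintype.mem_piFinset.2 fun l => (hF _ hF0 l).1,
      by simpa only [sub_add_cancel] using hne, funext fun l => sub_add_cancel _ _⟩

end Summit.QuantumFields.YangMills.Theorems.WeakCouplingHypercubicLimit.TraceNormColdPressure

end
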